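/-
Copyright (c) 2026 the pub-hodgecm-mathlib formalisation cell (harness21).  Prover seat hodgecm-mathlib-LH4-p01 (g12): road M6 → F5 → dyadic chain of `stub_DyUnramCore` (D-UNR),
site (L2-3) «THE WALL», CM-carrier row 1 «N5b-θ» of CENSUS-L23-CM v1 (LH10-p01 (g12)); 2026-09-03.
-/
import Literature.NumberTheory.Automorphic.UnitaryCarrierCongruenceNhdsBasis     -- ★ N5b p846670 (F0P3a-p06): `exists_level_forall_prod_mem_of_mem_nhds_one` (the congruence box) and the σ-fixed shift row (pattern); brings the one-place model ★ `coe_localNonsplitEquiv_apply`, ★ `isIntMatrix_inv_smul_iff`, ★ `conjLocal_apply_eq_of_smul_eq`, ★ `map_nonsing_inv_of_isUnit`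
import Literature.NumberTheory.Automorphic.MatrixMoebiusShiftHermitian           -- ★ P1 p853610 (LH10-p01 (g12)): `valued_hermitianMoebius_sub_one_le_of_level` (THE 2-FREE LEVEL LEMMA, pair `(θ, c−θ ∣ c−σθ, σθ)`)
import Literature.NumberTheory.Automorphic.MatrixGenMoebiusShift                 -- ★ p853671 (this seat): `map_genMoebius` (four-scalar ring-hom transport of `(aM + b)(b′M + a′)⁻¹`)
import HarnessLib

/-!
# «`u_H → 1` as `γ_H → 1`» for the HERMITIAN Cayley shift `φ_θ` — the 2-free twin of ★ N5b `exists_level_forall_shift_mem_of_mem_nhds_one` (Rogawski 1990 §4.9; Kottwitz 1986 §3)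

Topic `NumberTheory/Automorphic`; namespace `Literature.NumberTheory.Automorphic`.  THEOREMS ONLY (no definition, no instance, no notation, no named fact, no `sorry`);
kernel lane `--supports stmt-HodgeConjecture-24833`.  Cell `pub/hodgecm-mathlib` (D-0151), crux H413 = `stmt-HodgeConjecture-24833`; road M6 → F5 → the dyadic chain of organ
(D-UNR) `stub_DyUnramCore`, LEVEL TWO, site (L2-3) «THE WALL» = ★ `liftInterior_of_levelTwo` with `h2` deleted; this file is CM-carrier ROW 1 of LH10-p01 (g12)'s
CENSUS-L23-CM v1 (call site ★ `LevelTwoLiftInterior` :174): ★ N5b's «the shifted pair lies in `V′`» with the σ-FIXED Cayley pair `(c+1, c−1)` (which loses one level only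
because `|2|_w = 1`) replaced by the HERMITIAN pair `(θ, c−θ ∣ c−σθ, σθ)`, `θ + σθ = 1`, `θ` integral at `w` (★ L1 `exists_conjLocal_add_self_eq_one` supplies such a `θ` at
every unramified inert place, any residue characteristic), whose level drop `j + 1 ↦ j` is ★ P1 `valued_hermitianMoebius_sub_one_le_of_level` with NO hypothesis on `|2|`.

THE MATHEMATICS.  `L∕L⁺` CM, `v` finite non-split in `L` (`w ∣ v`, `σ • w = w`), `σ = conjLocal` (`= σ_w` at `w`, ★ `conjLocal_apply_eq_of_smul_eq`), `c ∈ L⁺_v ⊗ L`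
with `|c_w| = exp(−1)`, `θ` with `θ + σθ = 1`, `|θ_w| ≤ 1`.  The shift of the endoscopic carrier `C₂ × C₁ = U(Φ₂)(L⁺_v) × U(Φ₁)(L⁺_v)` is, componentwise,
`g ↦ (θ•g + (c−θ)•1)((c−σθ)•g + σθ•1)⁻¹` (`2 × 2`) and `u ↦ (θu + (c−θ))·((c−σθ)u + σθ)⁻¹` (the `U(Φ₁)` entry `γ₂`).  If `γ_H ≡ 1 (mod c_w^{j+1})` at `w` then
`u_H ≡ 1 (mod c_w^j)`: matrix part ★ P1; scalar part ★ P1 ED. 2 `valued_hermitianMoebius_scalar_sub_one_le_of_level` (`ψ(u) − 1 = (1−c)(u−1)∕D`, `D = c + (c−σθ)(u−1)`, `|D| = |c|`; §1 below: `D ≠ 0`).  Hence for every `V′ ∈ 𝓝 1` the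
congruence box of ★ `exists_level_forall_prod_mem_of_mem_nhds_one` gives `j ≥ 1` with `u_H ∈ V′` for every such pair — ★ N5b :142 token for token with
`(h2 : |2|_w = 1)` ↦ `(θ) (hθ) (hθv)` and `(c+1, c−1 ∣ c−1, c+1)` ↦ `(θ, c−θ ∣ c−σθ, σθ)` in the four shift binders (`hD hU h1 hu′`).
HONEST LABEL: HC_CM is proved only modulo the 7 printed citations (2 remaining: hLiu418 = stmt-HodgeConjecture-24832, h413 = stmt-HodgeConjecture-24833) until rung 0 closes;
count-neutral CM glue (zero label movement; L2-3 stays THE WALL until every row of CENSUS-L23-CM is paid).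

* §1 `hermitianMoebius_scalar_denom_ne_zero_of_level` (the scalar denominator is non-zero); the `1 × 1` level bound is ★ P1 ED. 2 `valued_hermitianMoebius_scalar_sub_one_le_of_level`
  (LH10-p01 (g12)) and the four-scalar transport `map_genMoebius` is ★ `MatrixGenMoebiusShift`;
* §2 **`exists_level_forall_hermitianShift_mem_of_mem_nhds_one`** (ROW 1).

## References
* [Rogawski1990] J. D. Rogawski, *Automorphic Representations of Unitary Groups in Three Variables*, Ann. of Math. Stud. 123 (1990): §4.9 Prop. 4.9.1 (b) p. 55.
* [Kottwitz1986BaseChangeUnits] R. E. Kottwitz, *Base change for unit elements of Hecke algebras*, Compositio Math. 60 (1986): §2 pp. 244–247, §3.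
* [BernsteinZelevinsky1976] I. N. Bernstein, A. V. Zelevinsky, *Representations of the group GL(n,F) where F is a non-archimedean local field*, Russian Math. Surveys 31
  (1976): §1.1 (congruence subgroups form a basis of neighbourhoods of `1`).
* [Weyl1939] H. Weyl, *The Classical Groups* (1939): Chap. II §10 (Cayley's rational parametrisation of the unitary group).
-/

set_option autoImplicit false

noncomputable section

open NumberField IsDedekindDomain Matrix ValuativeRel Topology Filter Set
open Literature.NumberTheory.Automorphic.UnitaryGroup Literature.NumberTheory.Automorphic.MoebiusShift
open Literature.NumberTheory.Rogawski1990 Literature.NumberTheory.GaloisRepresentations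
open scoped Matrix MatrixGroups ValuativeRel WithZero

namespace Literature.NumberTheory.Automorphic

/-! ## §1 The scalar level lemma -/

section Scalar

variable {K : Type*} [Field K] [Valued K ℤᵐ⁰]

/-- The denominator of the scalar hermitian shift does not vanish on the level-`(j+1)` ball: `D = (c−σθ)u + σθ = c + (c−σθ)(u−1)` has `|D| = |c| ≠ 0` for `|u − 1| ≤ |c|^{j+1}`,
`j ≥ 1`, `θ + σθ = 1`, `|θ| ≤ 1`, `|c| = exp(−1)` (companion of ★ P1 ED. 2 `valued_hermitianMoebius_scalar_sub_one_le_of_level`, which bounds `|ψ(u) − 1|`).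
[cite: Kottwitz1986BaseChangeUnits, §2 pp. 244–247] -/
theorem hermitianMoebius_scalar_denom_ne_zero_of_level (σ : K →+* K) {θ : K} (hθ : θ + σ θ = 1) (hθv : Valued.v θ ≤ 1)
    {c : K} (hc : Valued.v c = WithZero.exp (-1 : ℤ)) (u : K) {j : ℕ} (hj : 1 ≤ j) (hu : Valued.v (u - 1) ≤ Valued.v c ^ (j + 1)) :
    (c - σ θ) * u + σ θ ≠ 0 := by
  have hσθ : σ θ = 1 - θ := by linear_combination hθ
  have hσθv : Valued.v (σ θ) ≤ 1 := by rw [hσθ]; exact (Valuation.map_sub _ _ _).trans (max_le (by rw [map_one]) hθv)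
  have hc1 : Valued.v c < 1 := by rw [hc, ← WithZero.exp_zero]; exact WithZero.exp_lt_exp.2 (by norm_num)
  have htD : Valued.v (c - σ θ) ≤ 1 := (Valuation.map_sub _ _ _).trans (max_le hc1.le hσθv)
  have hDeq : (c - σ θ) * u + σ θ = c + (c - σ θ) * (u - 1) := by ring
  have hsmall : Valued.v ((c - σ θ) * (u - 1)) < Valued.v c := by
    rw [map_mul]
    calc Valued.v (c - σ θ) * Valued.v (u - 1) ≤ 1 * Valued.v c ^ (j + 1) := mul_le_mul' htD hu
      _ = Valued.v c ^ j * Valued.v c := by rw [one_mul, pow_succ]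
      _ < 1 * Valued.v c := by
          refine mul_lt_mul_of_pos_right ?_ (by rw [hc]; exact WithZero.exp_pos)
          exact pow_lt_one₀ zero_le hc1 (by omega)
      _ = Valued.v c := one_mul _
  have hDv : Valued.v ((c - σ θ) * u + σ θ) = Valued.v c := by
    rw [hDeq, Valuation.map_add_eq_of_lt_left _ hsmall]
  intro h
  rw [h, map_zero] at hDv
  exact WithZero.zero_ne_coe (hDv.trans hc)

end Scalar

/-! ## §2 ROW 1 «N5b-θ»: the shifted pair lies in `V′` -/

section CarrierNhds

variable (L : Type) [Field L] [NumberField L] [IsCMField L]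

set_option maxHeartbeats 800000 in
-- budget only: one statement-heavy declaration (the four hermitian shift binders in the one-place model); no search tactic runs long here.
/-- **«`u_H → 1` as `γ_H → 1`» for the HERMITIAN Cayley shift** (CM-carrier row 1 of the 2-free organ (I)): given `V′ ∈ 𝓝 1` in the endoscopic carrier there is `j ≥ 1`
such that every pair `(γ_H, u_H)` with `u_H = φ_θ(γ_H)` componentwise — `g′ = (θ•g + (c−θ)•1)((c−σθ)•g + σθ•1)⁻¹`, `u′ = (θu + (c−θ))·((c−σθ)u + σθ)⁻¹`, denominators
invertible (binders `hD hU h1 hu′`), `σ = conjLocal`, `θ + σθ = 1`, `|θ_w| ≤ 1` — and `γ_H ≡ 1 (mod c_w^{j+1})` at `w` has `u_H ∈ V′`: the shift loses exactly one level at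
EVERY residue characteristic (★ P1 `valued_hermitianMoebius_sub_one_le_of_level`; ★ P1 ED. 2 `valued_hermitianMoebius_scalar_sub_one_le_of_level` + §1 for the `U(Φ₁)` entry).  ★ N5b `exists_level_forall_shift_mem_of_mem_nhds_one` is the
σ-fixed pair `(c+1, c−1)` under `|2|_w = 1`; here NO hypothesis on `|2|`. [cite: Rogawski1990, §4.9 Prop. 4.9.1 (b) p. 55] [cite: Kottwitz1986BaseChangeUnits, §3]
[cite: BernsteinZelevinsky1976, §1.1] -/
theorem exists_level_forall_hermitianShift_mem_of_mem_nhds_one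
    {v : HeightOneSpectrum (𝓞 ↥(maximalRealSubfield L))}
    (w : UnitaryGroup.PlacesOver L v) (hw : IsCMField.complexConj L • w.1 = w.1)
    {c : LocalRing L v} (hc : Valued.v (c w) = WithZero.exp (-1 : ℤ))
    {θ : LocalRing L v} (hθ : θ + conjLocal L (IsCMField.complexConj L) v θ = 1) (hθv : Valued.v (θ w) ≤ 1)
    {V' : Set (((cmDatum L 2 (Matrix.of fun i j : Fin 2 => if i.val + j.val + 1 = 2 then (1 : L) else 0)).Local v) × ((cmDatum L 1 (Matrix.of fun i j : Fin 1 => if i.val + j.val + 1 = 1 then (1 : L) else 0)).Local v))} (hV' : V' ∈ 𝓝 (1 : (((cmDatum L 2 (Matrix.of fun i j : Fin 2 => if i.val + j.val + 1 = 2 then (1 : L) else 0)).Local v) × ((cmDatum L 1 (Matrix.of fun i j : Fin 1 => if i.val + j.val + 1 = 1 then (1 : L) else 0)).Local v)))) :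
    ∃ j : ℕ, 1 ≤ j ∧ ∀ γH uH : (((cmDatum L 2 (Matrix.of fun i j : Fin 2 => if i.val + j.val + 1 = 2 then (1 : L) else 0)).Local v) × ((cmDatum L 1 (Matrix.of fun i j : Fin 1 => if i.val + j.val + 1 = 1 then (1 : L) else 0)).Local v)),
      (∀ i k, Valued.v (((((γH.1.val : GL (Fin 2) (LocalRing L v)).val : Matrix (Fin 2) (Fin 2) (LocalRing L v))).map (Pi.evalRingHom (fun w' : UnitaryGroup.PlacesOver L v => w'.1.adicCompletion L) w) - 1) i k) ≤ Valued.v (c w) ^ (j + 1)) →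
      Valued.v (finGammaTwo L v γH w - 1) ≤ Valued.v (c w) ^ (j + 1) →
      IsUnit ((c - conjLocal L (IsCMField.complexConj L) v θ) • ((γH.1.val : GL (Fin 2) (LocalRing L v)).val : Matrix (Fin 2) (Fin 2) (LocalRing L v)) + conjLocal L (IsCMField.complexConj L) v θ • (1 : Matrix (Fin 2) (Fin 2) (LocalRing L v))).det →
      IsUnit ((c - conjLocal L (IsCMField.complexConj L) v θ) * finGammaTwo L v γH + conjLocal L (IsCMField.complexConj L) v θ) →
      ((uH.1.val : GL (Fin 2) (LocalRing L v)).val : Matrix (Fin 2) (Fin 2) (LocalRing L v)) =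
        (θ • ((γH.1.val : GL (Fin 2) (LocalRing L v)).val : Matrix (Fin 2) (Fin 2) (LocalRing L v)) + (c - θ) • 1) *
          ((c - conjLocal L (IsCMField.complexConj L) v θ) • ((γH.1.val : GL (Fin 2) (LocalRing L v)).val : Matrix (Fin 2) (Fin 2) (LocalRing L v)) + conjLocal L (IsCMField.complexConj L) v θ • 1)⁻¹ →
      finGammaTwo L v uH = (θ * finGammaTwo L v γH + (c - θ)) * Ring.inverse ((c - conjLocal L (IsCMField.complexConj L) v θ) * finGammaTwo L v γH + conjLocal L (IsCMField.complexConj L) v θ) →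
      uH ∈ V' := by
  classical
  haveI : Algebra.IsQuadraticExtension ↥(maximalRealSubfield L) L := IsCMField.isQuadraticExtension L
  have hc0 : c w ≠ 0 := fun h => by rw [h, map_zero] at hc; exact WithZero.zero_ne_coe hc
  have hc1' : Valued.v (c w) < 1 := by
    rw [hc, ← WithZero.exp_zero]; exact WithZero.exp_lt_exp.2 (by norm_num)
  -- `σ` at `w` is `σ_w`, and `θ_w + σ_w θ_w = 1`
  set σw := galAdicCompletionMap (L := L) (IsCMField.complexConj L) hw with hσw
  have hσθw : conjLocal L (IsCMField.complexConj L) v θ w = σw (θ w) :=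
    conjLocal_apply_eq_of_smul_eq (IsCMField.complexConj L) (IsCMField.complexConj_ne_one L) v w hw θ
  have hθw : θ w + σw (θ w) = 1 := by
    have h := congrArg (fun f : LocalRing L v => f w) hθ
    simpa only [Pi.add_apply, Pi.one_apply, hσθw] using h
  obtain ⟨j, hj, hV⟩ := exists_level_forall_prod_mem_of_mem_nhds_one L w hw hc0 hc1' hV'
  refine ⟨j, hj, fun γH uH hg hu hD hU h1 hu' => hV uH ?_ ?_⟩
  · -- the `U(Φ₂)`-component: `(u_H.1)_w = φ_θ(g_w)` loses one level (★ P1)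
    have hmat : ((((localNonsplitEquiv (IsCMField.complexConj L) (Matrix.of fun i j : Fin 2 => if i.val + j.val + 1 = 2 then (1 : L) else 0) (IsCMField.complexConj_ne_one L) w hw uH.1) : ↥(unitaryGroupOfForm (galAdicCompletionMap (L := L) (IsCMField.complexConj L) hw) (placeForm (Matrix.of fun i j : Fin 2 => if i.val + j.val + 1 = 2 then (1 : L) else 0) w.1))) : GL (Fin 2) (w.1.adicCompletion L)) : Matrix (Fin 2) (Fin 2) (w.1.adicCompletion L)) =
        (θ w • (((γH.1.val : GL (Fin 2) (LocalRing L v)).val : Matrix (Fin 2) (Fin 2) (LocalRing L v))).map (Pi.evalRingHom (fun w' : UnitaryGroup.PlacesOver L v => w'.1.adicCompletion L) w) + (c w - θ w) • (1 : Matrix (Fin 2) (Fin 2) (w.1.adicCompletion L))) *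
          ((c w - σw (θ w)) • (((γH.1.val : GL (Fin 2) (LocalRing L v)).val : Matrix (Fin 2) (Fin 2) (LocalRing L v))).map (Pi.evalRingHom (fun w' : UnitaryGroup.PlacesOver L v => w'.1.adicCompletion L) w) + σw (θ w) • (1 : Matrix (Fin 2) (Fin 2) (w.1.adicCompletion L)))⁻¹ := by
      rw [coe_localNonsplitEquiv_apply L (Matrix.of fun i j : Fin 2 => if i.val + j.val + 1 = 2 then (1 : L) else 0) v w hw uH.1]
      show (((uH.1.val : GL (Fin 2) (LocalRing L v)).val : Matrix (Fin 2) (Fin 2) (LocalRing L v))).map (Pi.evalRingHom (fun w' : UnitaryGroup.PlacesOver L v => w'.1.adicCompletion L) w) = _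
      rw [h1, map_genMoebius (Pi.evalRingHom (fun w' : UnitaryGroup.PlacesOver L v => w'.1.adicCompletion L) w) _ _ _ _ _ hD, map_sub, map_sub]
      simp only [Pi.evalRingHom_apply, hσθw]
    have hlev := (valued_hermitianMoebius_sub_one_le_of_level σw hθw hθv hc ((((γH.1.val : GL (Fin 2) (LocalRing L v)).val : Matrix (Fin 2) (Fin 2) (LocalRing L v))).map (Pi.evalRingHom (fun w' : UnitaryGroup.PlacesOver L v => w'.1.adicCompletion L) w)) hj hg).1
    refine (isIntMatrix_inv_smul_iff (pow_ne_zero _ hc0) _).2 fun a b => ?_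
    rw [Valuation.map_pow, hmat]
    exact hlev a b
  · -- the `U(Φ₁)`-component: the entry `γ₂(u_H)_w = ψ_θ(γ₂(γ_H)_w)`
    have hmul : finGammaTwo L v uH * ((c - conjLocal L (IsCMField.complexConj L) v θ) * finGammaTwo L v γH + conjLocal L (IsCMField.complexConj L) v θ) =
        θ * finGammaTwo L v γH + (c - θ) := by
      rw [hu', mul_assoc, Ring.inverse_mul_cancel _ hU, mul_one]
    have hw' : finGammaTwo L v uH w * ((c w - σw (θ w)) * finGammaTwo L v γH w + σw (θ w)) =
        θ w * finGammaTwo L v γH w + (c w - θ w) := by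
      have h := congrArg (fun f : LocalRing L v => f w) hmul
      simpa only [Pi.mul_apply, Pi.add_apply, Pi.sub_apply, Pi.one_apply, hσθw] using h
    have hden := hermitianMoebius_scalar_denom_ne_zero_of_level σw hθw hθv hc (finGammaTwo L v γH w) hj hu
    have hlev := (MoebiusShift.valued_hermitianMoebius_scalar_sub_one_le_of_level σw hθw hθv hc (finGammaTwo L v γH w) hj hu).1
    have huw : finGammaTwo L v uH w =
        (θ w * finGammaTwo L v γH w + (c w - θ w)) / ((c w - σw (θ w)) * finGammaTwo L v γH w + σw (θ w)) := by
      rw [eq_div_iff hden]; exact hw'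
    refine (isIntMatrix_inv_smul_iff (pow_ne_zero _ hc0) _).2 fun a b => ?_
    have ha : a = 0 := Subsingleton.elim _ _
    have hb : b = 0 := Subsingleton.elim _ _
    subst ha; subst hb
    rw [Valuation.map_pow, Matrix.sub_apply, coe_localNonsplitEquiv_apply L (Matrix.of fun i j : Fin 1 => if i.val + j.val + 1 = 1 then (1 : L) else 0) v w hw uH.2, Matrix.one_apply_eq]
    show Valued.v (finGammaTwo L v uH w - 1) ≤ _
    rw [huw]; exact hlev

end CarrierNhds

end Literature.NumberTheory.Automorphic

end
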